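import Literature.Analysis.FluidPDE.HouSelfSimilarCirculationSign
import HarnessLib

/-!
# The circulation exponent at critical and stagnation points of Hou's steady profile system;
# the inviscid corner `c_u + 2c_l = 0` (`ĉ_l = ½`)

Topic `Literature/Analysis/FluidPDE`. Theorems only, about the tree's predicate
`HouSelfSimilarProfile n ν₀ cl cu U Ω Ψ` (`HouTwoScaleRescaling.lean`; Hou, arXiv:2405.10916 §3) and
its steady rescaled circulation equation `HouSelfSimilarProfile.circulation_eq`
(`HouSelfSimilarCirculationSign.lean`): for `Γ̃ = ξ²ũ₁` and `ξ > 0`,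
`(c_lξ + ũ^ξ)Γ̃_ξ + (c_lη + ũ^η)Γ̃_η = c_Γ Γ̃ + ν₀ Δ̃Γ̃`, `c_Γ = c_u + 2c_l`,
`Δ̃Γ̃ = Γ̃_ξξ + ((n−4)/ξ)Γ̃_ξ + ((6−2n)/ξ²)Γ̃ + Γ̃_ηη`.

## What is proved (pointwise IDENTITIES — no maximum principle, no decay hypothesis)

* `circulationExponent_mul_eq_of_stagnation` — at a point `q`, `ξ > 0`, where the similarity
  characteristic field vanishes, `c_lξ + ũ^ξ(q) = 0 = c_lη + ũ^η(q)` (a STAGNATION point of the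
  co-moving relative flow `Ẏ = c_lY + ũ(Y)`), `c_Γ Γ̃(q) = −ν₀ Δ̃Γ̃(q)`.
* `circulationExponent_eq_zero_of_stagnation_of_inviscid` — **the inviscid corner**: for `ν₀ = 0`, a
  stagnation point carrying swirl (`ũ₁(q) ≠ 0`) forces `c_u + 2c_l = 0`, i.e. (`collapseExponent_eq_half`)
  EXACTLY the Navier–Stokes gauge `ĉ_l = c_l/(−c_u) = ½` on the blow-up side `κ = −c_u > 0`. (Steady
  inviscid circulation is transported, `(c_lY + ũ)·∇Γ̃ = c_ΓΓ̃`; at a fixed point of the transport the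
  left side vanishes.) Compare the viscous strict inequality `0 < c_u + 2c_l` for decaying circulation
  (`HouSelfSimilarCirculationStrict.lean`): the parabolic value `½` is the INVISCID value at a
  swirl-carrying stagnation point and is never attained at `ν₀ > 0` with decaying circulation.
* `circulationExponent_mul_eq_of_critical` — at a critical point of `Γ̃` (`Γ̃_ξ = Γ̃_η = 0`, `ξ > 0`; e.g.
  its interior maximum), `c_Γ Γ̃(q) = −ν₀ (Γ̃_ξξ + Γ̃_ηη + ((6−2n)/ξ²)Γ̃)(q)`; hence
  (`circulationExponent_eq_of_critical`) `c_Γ = ν₀ · (−(Γ̃_ξξ + Γ̃_ηη) − (6−2n)Γ̃/ξ²)(q) / Γ̃(q)` when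
  `Γ̃(q) ≠ 0` — the excess `ĉ_l − ½ = c_Γ/(2κ)` is `ν₀` times the relative curvature of the circulation
  at its critical point: a computable consistency identity for numerical profiles (the `ns-blowup`
  zone-Z5 (S) instrument prints both sides), and the reason `ĉ_l → ½` as `ν₀ → 0` requires the
  curvature-to-height ratio of `Γ̃` at its maximum to grow slower than `1/ν₀`.

## WHAT THIS IS NOT

Not an existence statement and nothing about Navier–Stokes: identities satisfied by HYPOTHETICAL
smooth solutions of a MODEL profile system (real dimension parameter `n`, solution-dependent
viscosity law), at special points whose existence is a hypothesis.

Search: tree `HouSelfSimilarProfile.circulation_eq` (p506281), `GeneralizedAxisymNS.radialVel/axialVel`,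
`HouScalingExponents.{hat, kappa_eq_neg_cu}`; nothing on stagnation points of the similarity flow
existed (`lean search 'stagnation'` in FluidPDE: unrelated hits only).
-/

noncomputable section

open Set Filter
open scoped Topology ContDiff

namespace Literature.Analysis.FluidPDE

namespace HouSelfSimilarProfile

variable {n ν₀ cl cu : ℝ} {U Ω Ψ : ℝ × ℝ → ℝ}

/-- **Stagnation-point identity.** At `q`, `ξ > 0`, with `c_lξ + ũ^ξ(q) = 0` and `c_lη + ũ^η(q) = 0`
(a fixed point of the similarity characteristics `Ẏ = c_lY + ũ`), the steady circulation equation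
reduces to `c_Γ Γ̃(q) = −ν₀ Δ̃Γ̃(q)`, `c_Γ = c_u + 2c_l`. [cite: Hou2026, §3 (rescaled Γ̃-equation, c_Γ = c_u + 2c_lr)] -/
theorem circulationExponent_mul_eq_of_stagnation (hP : HouSelfSimilarProfile n ν₀ cl cu U Ω Ψ)
    {q : ℝ × ℝ} (hq : 0 < q.1)
    (hsr : cl * q.1 + GeneralizedAxisymNS.radialVel Ψ q = 0)
    (hsz : cl * q.2 + GeneralizedAxisymNS.axialVel n Ψ q = 0) :
    (cu + 2 * cl) * (q.1 ^ 2 * U q) =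
      -(ν₀ * (derivR (derivR fun p : ℝ × ℝ => p.1 ^ 2 * U p) q +
          (n - 4) / q.1 * derivR (fun p : ℝ × ℝ => p.1 ^ 2 * U p) q +
          (6 - 2 * n) / q.1 ^ 2 * (q.1 ^ 2 * U q) +
          derivZ (derivZ fun p : ℝ × ℝ => p.1 ^ 2 * U p) q)) := by
  have hce := hP.circulation_eq hq
  have h1 : cl * q.1 * derivR (fun p : ℝ × ℝ => p.1 ^ 2 * U p) q +
        cl * q.2 * derivZ (fun p : ℝ × ℝ => p.1 ^ 2 * U p) q +
        GeneralizedAxisymNS.radialVel Ψ q * derivR (fun p : ℝ × ℝ => p.1 ^ 2 * U p) q +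
        GeneralizedAxisymNS.axialVel n Ψ q * derivZ (fun p : ℝ × ℝ => p.1 ^ 2 * U p) q =
      (cl * q.1 + GeneralizedAxisymNS.radialVel Ψ q) * derivR (fun p : ℝ × ℝ => p.1 ^ 2 * U p) q +
        (cl * q.2 + GeneralizedAxisymNS.axialVel n Ψ q) *
          derivZ (fun p : ℝ × ℝ => p.1 ^ 2 * U p) q := by ring
  rw [h1, hsr, hsz, zero_mul, zero_mul, zero_add] at hce
  linarith [hce]

/-- **The inviscid corner.** For `ν₀ = 0`, a stagnation point `q` (`ξ > 0`) of the similarity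
characteristics at which the swirl does not vanish forces `c_u + 2c_l = 0`: steady inviscid
circulation is purely transported, `(c_lY + ũ)·∇Γ̃ = c_ΓΓ̃`, and the left side vanishes at `q`.
[cite: Hou2026, §3 (rescaled Γ̃-equation, c_Γ = c_u + 2c_lr)] -/
theorem circulationExponent_eq_zero_of_stagnation_of_inviscid
    (hP : HouSelfSimilarProfile n ν₀ cl cu U Ω Ψ) (hν : ν₀ = 0)
    {q : ℝ × ℝ} (hq : 0 < q.1)
    (hsr : cl * q.1 + GeneralizedAxisymNS.radialVel Ψ q = 0)
    (hsz : cl * q.2 + GeneralizedAxisymNS.axialVel n Ψ q = 0) (hU : U q ≠ 0) :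
    cu + 2 * cl = 0 := by
  have h := hP.circulationExponent_mul_eq_of_stagnation hq hsr hsz
  rw [hν, zero_mul, neg_zero] at h
  have hΓ : q.1 ^ 2 * U q ≠ 0 := mul_ne_zero (pow_ne_zero 2 hq.ne') hU
  exact (mul_eq_zero.1 h).resolve_right hΓ

/-- **Critical-point identity.** At a critical point of `Γ̃ = ξ²ũ₁` (`Γ̃_ξ(q) = Γ̃_η(q) = 0`, `ξ > 0`;
e.g. an interior extremum), `c_Γ Γ̃(q) = −ν₀ (Γ̃_ξξ + Γ̃_ηη + ((6 − 2n)/ξ²) Γ̃)(q)`.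
[cite: Hou2026, §3 (rescaled Γ̃-equation, c_Γ = c_u + 2c_lr)] -/
theorem circulationExponent_mul_eq_of_critical (hP : HouSelfSimilarProfile n ν₀ cl cu U Ω Ψ)
    {q : ℝ × ℝ} (hq : 0 < q.1)
    (hR : derivR (fun p : ℝ × ℝ => p.1 ^ 2 * U p) q = 0)
    (hZ : derivZ (fun p : ℝ × ℝ => p.1 ^ 2 * U p) q = 0) :
    (cu + 2 * cl) * (q.1 ^ 2 * U q) =
      -(ν₀ * (derivR (derivR fun p : ℝ × ℝ => p.1 ^ 2 * U p) q +
          derivZ (derivZ fun p : ℝ × ℝ => p.1 ^ 2 * U p) q +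
          (6 - 2 * n) / q.1 ^ 2 * (q.1 ^ 2 * U q))) := by
  have hce := hP.circulation_eq hq
  rw [hR, hZ] at hce
  simp only [mul_zero, add_zero] at hce
  linarith [hce]

/-- **The circulation exponent from the profile at one point.** At a critical point of `Γ̃` with
`Γ̃(q) ≠ 0` (`ξ > 0`): `c_u + 2c_l = ν₀ · (−(Γ̃_ξξ + Γ̃_ηη)(q) − (6 − 2n) Γ̃(q)/ξ²) / Γ̃(q)` — at
`n = 3` the excess of `ĉ_l` over `½` is `ν₀` times (minus) the relative curvature of the circulation
at its critical point. [cite: Hou2026, §3 (rescaled Γ̃-equation, c_Γ = c_u + 2c_lr)] -/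
theorem circulationExponent_eq_of_critical (hP : HouSelfSimilarProfile n ν₀ cl cu U Ω Ψ)
    {q : ℝ × ℝ} (hq : 0 < q.1)
    (hR : derivR (fun p : ℝ × ℝ => p.1 ^ 2 * U p) q = 0)
    (hZ : derivZ (fun p : ℝ × ℝ => p.1 ^ 2 * U p) q = 0) (hΓ : q.1 ^ 2 * U q ≠ 0) :
    cu + 2 * cl =
      ν₀ * (-(derivR (derivR fun p : ℝ × ℝ => p.1 ^ 2 * U p) q +
              derivZ (derivZ fun p : ℝ × ℝ => p.1 ^ 2 * U p) q) -
            (6 - 2 * n) * (q.1 ^ 2 * U q) / q.1 ^ 2) / (q.1 ^ 2 * U q) := by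
  have h := hP.circulationExponent_mul_eq_of_critical hq hR hZ
  have hξ : q.1 ^ 2 ≠ 0 := pow_ne_zero 2 hq.ne'
  rw [eq_div_iff hΓ]
  rw [h]
  field_simp
  ring

/-- **Inviscid critical points carry no information / viscous ones do:** for `ν₀ = 0` the critical-point
identity is `c_Γ Γ̃(q) = 0`, so either `c_u + 2c_l = 0` or the swirl vanishes at every critical point of
`Γ̃` in the open half-plane. [cite: Hou2026, §3 (rescaled Γ̃-equation, c_Γ = c_u + 2c_lr)] -/
theorem circulationExponent_eq_zero_or_swirl_eq_zero_of_critical_of_inviscid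
    (hP : HouSelfSimilarProfile n ν₀ cl cu U Ω Ψ) (hν : ν₀ = 0)
    {q : ℝ × ℝ} (hq : 0 < q.1)
    (hR : derivR (fun p : ℝ × ℝ => p.1 ^ 2 * U p) q = 0)
    (hZ : derivZ (fun p : ℝ × ℝ => p.1 ^ 2 * U p) q = 0) :
    cu + 2 * cl = 0 ∨ U q = 0 := by
  have h := hP.circulationExponent_mul_eq_of_critical hq hR hZ
  rw [hν, zero_mul, neg_zero] at h
  rcases mul_eq_zero.1 h with h1 | h2
  · exact Or.inl h1
  · exact Or.inr ((mul_eq_zero.1 h2).resolve_left (pow_ne_zero 2 hq.ne'))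

end HouSelfSimilarProfile

/-! ### Dictionary: `c_u + 2c_l = 0` is the Navier–Stokes gauge `ĉ_l = ½` -/

/-- On the blow-up side `κ = −c_u > 0`, `c_u + 2c_l = 0` reads `ĉ_l = c_l/(−c_u) = ½` exactly: the
normalized length exponent at which the solution-dependent viscosity `ν₀(T−t)^{2ĉ_l−1}` of
arXiv:2405.10916 §1.1 is CONSTANT (the Navier–Stokes-admissible self-similar gauge).
[cite: Hou2026, §1.1 (ν = ν₀(T−t)^{2c_l−1})] -/
theorem collapseExponent_eq_half {cl cu : ℝ} (h : cu + 2 * cl = 0) (hκ : 0 < -cu) :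
    cl / (-cu) = 1 / 2 := by
  rw [div_eq_iff hκ.ne']
  linarith

/-- The same in the vocabulary of `HouScalingExponents` (one-scale regime `c_lr = c_lz = c_l`,
`κ = −c_u`): `c_u + 2c_lz = 0`, `κ > 0` ⇒ `ĉ_lz = ½`, so the viscosity-law exponent `2ĉ_lz − 1` of
`physicalViscosity_eq_rpow` vanishes. [cite: Hou2026, §1.1 (ν = ν₀(T−t)^{2c_l−1})] -/
theorem HouScalingExponents.hat_clz_eq_half (e : HouScalingExponents) (h : e.cu + 2 * e.clz = 0)
    (hκ : 0 < e.kappa) : e.hat e.clz = 1 / 2 := by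
  rw [HouScalingExponents.hat, div_eq_iff hκ.ne']
  have := e.kappa_eq_neg_cu
  linarith

end Literature.Analysis.FluidPDE
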